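import Mathlib

/-!
# Route StarvedNecks — crux `NecksCertify`, line `bargmann-small-late-exterior`: rung R1

Stub `stub_tonelliBargmann` (statement `TonelliBargmann` of the line skeleton, verbatim): the pure
measure theory of the Bargmann weight consumed by the model rungs M1 (sup-norm contraction) and
M2 (no parking).  For `ν ≥ 0` continuous on `[R₀, ∞)` with `(s − R₀) ν(s)` integrable on
`(R₀, ∞)`:

* `ν` is integrable on `(R₀, ∞)` (bounded on the compact `[R₀, R₀ + 1]`, dominated by
  `(s − R₀) ν(s)` on `(R₀ + 1, ∞)`);
* the tails `I_L(ρ) = ∫_{(ρ+L, ∞)} ν` (`L ≥ 0`) are nonnegative and antitone in `ρ ≥ R₀`;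
* the double-integral bound `∫_{R₀}^{r} I_L(ρ) dρ ≤ ∫_{(R₀+L, ∞)} (s − R₀) ν(s) ds`: by Fubini on
  `(R₀, r] × (R₀ + L, ∞)` for the integrable integrand `1[ρ + L < s] ν(s)`, the swapped inner
  integral is `λ((R₀, r] ∩ (−∞, s − L)) · ν(s) ≤ (s − L − R₀) ν(s) ≤ (s − R₀) ν(s)`;
* both tails `∫_{(a, ∞)} ν` and `∫_{(a, ∞)} (s − R₀) ν` tend to `0` as `a → ∞`
  (`tendsto_setIntegral_of_antitone` with `⋂ₐ (a, ∞) = ∅`).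

Mathlib only; no named facts.
-/

noncomputable section

namespace Summit.FinalStateConjecture.FinalStateConjecture.Theorems.NecksCertifyBargmann.Tonelli

open Filter Topology MeasureTheory Set
open scoped Topology

/-- Integrability of `ν` on `(R₀, ∞)` from continuity on `[R₀, ∞)`, nonnegativity there, and
integrability of the weighted function `(s - R₀) ν s` on `(R₀, ∞)`: on `(R₀, R₀ + 1]` use
continuity on the compact `[R₀, R₀ + 1]`, on `(R₀ + 1, ∞)` the domination `ν s ≤ (s - R₀) ν s`. -/
theorem integrableOn_Ioi_of_weighted {R₀ : ℝ} {ν : ℝ → ℝ} (hc : ContinuousOn ν (Ici R₀))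
    (hnn : ∀ s, R₀ ≤ s → 0 ≤ ν s)
    (hint : IntegrableOn (fun s ↦ (s - R₀) * ν s) (Ioi R₀)) :
    IntegrableOn ν (Ioi R₀) := by
  have h1 : IntegrableOn ν (Ioc R₀ (R₀ + 1)) :=
    (hc.mono Icc_subset_Ici_self).integrableOn_Icc.mono_set Ioc_subset_Icc_self
  have h2 : IntegrableOn ν (Ioi (R₀ + 1)) := by
    have hsub : Ioi (R₀ + 1) ⊆ Ioi R₀ := Ioi_subset_Ioi (by linarith)
    refine Integrable.mono' (hint.mono_set hsub) ?_ ?_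
    · exact (hc.mono fun s (hs : R₀ + 1 < s) ↦ show R₀ ≤ s by linarith).aestronglyMeasurable
        measurableSet_Ioi
    · refine ae_restrict_of_forall_mem measurableSet_Ioi fun s (hs : R₀ + 1 < s) ↦ ?_
      have hν : 0 ≤ ν s := hnn s (by linarith)
      rw [Real.norm_eq_abs, abs_of_nonneg hν]
      nlinarith
  have h12 := h1.union h2
  rwa [Ioc_union_Ioi_eq_Ioi (by linarith)] at h12

/-- Tail integrals `∫_{(ρ + L, ∞)} ν` of a function nonnegative on `[R₀, ∞)` are nonnegative for
`L ≥ 0`, `ρ ≥ R₀`. -/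
theorem tail_nonneg {R₀ : ℝ} {ν : ℝ → ℝ} (hnn : ∀ s, R₀ ≤ s → 0 ≤ ν s) {L ρ : ℝ} (hL : 0 ≤ L)
    (hρ : R₀ ≤ ρ) : 0 ≤ ∫ s in Ioi (ρ + L), ν s :=
  setIntegral_nonneg measurableSet_Ioi fun s (hs : ρ + L < s) ↦ hnn s (by linarith)

/-- Tail integrals `ρ ↦ ∫_{(ρ + L, ∞)} ν` (`L ≥ 0`) of a function nonnegative on `[R₀, ∞)` and
integrable on `(R₀, ∞)` are antitone on `[R₀, ∞)` (smaller domain, nonnegative integrand). -/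
theorem tail_antitoneOn {R₀ : ℝ} {ν : ℝ → ℝ} (hnn : ∀ s, R₀ ≤ s → 0 ≤ ν s)
    (hν : IntegrableOn ν (Ioi R₀)) {L : ℝ} (hL : 0 ≤ L) :
    AntitoneOn (fun ρ ↦ ∫ s in Ioi (ρ + L), ν s) (Ici R₀) := by
  intro ρ₁ hρ₁ ρ₂ _ h12
  have hρ₁' : R₀ ≤ ρ₁ := hρ₁
  show ∫ s in Ioi (ρ₂ + L), ν s ≤ ∫ s in Ioi (ρ₁ + L), ν s
  refine setIntegral_mono_set (hν.mono_set (Ioi_subset_Ioi (by linarith))) ?_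
    (Filter.Eventually.of_forall (Ioi_subset_Ioi (by linarith)))
  exact ae_restrict_of_forall_mem measurableSet_Ioi fun s (hs : ρ₁ + L < s) ↦ hnn s (by linarith)

/-- **Fubini bound for the Bargmann weight.**  For `ν` nonnegative on `[R₀, ∞)`, integrable on
`(R₀, ∞)` together with `(s - R₀) ν s`, and `L ≥ 0`, `r ≥ R₀`:
`∫_{R₀}^{r} (∫_{(ρ + L, ∞)} ν) dρ ≤ ∫_{(R₀ + L, ∞)} (s - R₀) ν(s) ds`.  Proof: write the inner
integral as `∫_{(R₀+L, ∞)} 1[ρ + L < s] ν(s) ds`, swap the two integrals (the integrand is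
integrable on the product of the two restricted Lebesgue measures, being an indicator times
`ν ∘ snd`), and bound the new inner integral `λ((R₀, r] ∩ (-∞, s - L)) ν(s)` by
`(s - L - R₀) ν(s) ≤ (s - R₀) ν(s)`. -/
theorem double_integral_le {R₀ : ℝ} {ν : ℝ → ℝ} (hnn : ∀ s, R₀ ≤ s → 0 ≤ ν s)
    (hν : IntegrableOn ν (Ioi R₀)) (hint : IntegrableOn (fun s ↦ (s - R₀) * ν s) (Ioi R₀))
    {L r : ℝ} (hL : 0 ≤ L) (hr : R₀ ≤ r) :
    ∫ ρ in R₀..r, (∫ s in Ioi (ρ + L), ν s) ≤ ∫ s in Ioi (R₀ + L), (s - R₀) * ν s := by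
  -- the integrand on the product, kept opaque behind the equation `hF`
  obtain ⟨F, hF⟩ : ∃ F : ℝ → ℝ → ℝ, F = fun ρ s ↦ if ρ + L < s then ν s else 0 := ⟨_, rfl⟩
  have hνB : IntegrableOn ν (Ioi (R₀ + L)) := hν.mono_set (Ioi_subset_Ioi (by linarith))
  -- integrability of the uncurried integrand for the product of the restricted measures
  have hFint : Integrable (Function.uncurry F)
      ((volume.restrict (Ioc R₀ r)).prod (volume.restrict (Ioi (R₀ + L)))) := by
    have hSm : MeasurableSet {p : ℝ × ℝ | p.1 + L < p.2} :=
      measurableSet_lt (measurable_fst.add_const L) measurable_snd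
    have hg : Integrable (fun p : ℝ × ℝ ↦ ν p.2)
        ((volume.restrict (Ioc R₀ r)).prod (volume.restrict (Ioi (R₀ + L)))) :=
      hνB.comp_snd _
    have huF : Function.uncurry F = {p : ℝ × ℝ | p.1 + L < p.2}.indicator fun p ↦ ν p.2 := by
      funext ⟨ρ, s⟩
      simp only [hF, Function.uncurry_apply_pair, Set.indicator_apply, Set.mem_setOf_eq]
    rw [huF]
    exact hg.indicator hSm
  -- Step 1: the left side as an iterated integral of `F` over the two restricted measures
  have step1 : ∫ ρ in R₀..r, (∫ s in Ioi (ρ + L), ν s)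
      = ∫ ρ in Ioc R₀ r, ∫ s in Ioi (R₀ + L), F ρ s := by
    rw [intervalIntegral.integral_of_le hr]
    refine setIntegral_congr_fun measurableSet_Ioc fun ρ hρ ↦ ?_
    have hρ1 : R₀ < ρ := hρ.1
    have hF' : F ρ = (Ioi (ρ + L)).indicator ν := by
      funext s
      simp only [hF, Set.indicator_apply, Set.mem_Ioi]
    show ∫ s in Ioi (ρ + L), ν s = ∫ s in Ioi (R₀ + L), F ρ s
    rw [hF', setIntegral_indicator measurableSet_Ioi,
      Set.inter_eq_right.mpr (Ioi_subset_Ioi (by linarith))]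
  -- Step 2: Fubini
  have step2 : ∫ ρ in Ioc R₀ r, ∫ s in Ioi (R₀ + L), F ρ s
      = ∫ s in Ioi (R₀ + L), ∫ ρ in Ioc R₀ r, F ρ s :=
    integral_integral_swap hFint
  -- Step 3: the swapped inner integral is at most `(s - R₀) ν s`
  have step3 : ∀ s ∈ Ioi (R₀ + L), ∫ ρ in Ioc R₀ r, F ρ s ≤ (s - R₀) * ν s := by
    intro s hs
    have hs' : R₀ + L < s := hs
    have hνs : 0 ≤ ν s := hnn s (by linarith)
    have hF' : (fun ρ ↦ F ρ s) = (Iio (s - L)).indicator fun _ ↦ ν s := by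
      funext ρ
      simp only [hF, Set.indicator_apply, Set.mem_Iio, lt_sub_iff_add_lt]
    have hI : ∫ ρ in Ioc R₀ r, F ρ s = volume.real (Ioc R₀ r ∩ Iio (s - L)) * ν s := by
      rw [show (∫ ρ in Ioc R₀ r, F ρ s) = ∫ ρ in Ioc R₀ r, (Iio (s - L)).indicator (fun _ ↦ ν s) ρ
          from by rw [← hF'],
        setIntegral_indicator measurableSet_Iio, setIntegral_const, smul_eq_mul]
    have hmeas : volume.real (Ioc R₀ r ∩ Iio (s - L)) ≤ s - R₀ := by
      calc volume.real (Ioc R₀ r ∩ Iio (s - L))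
          ≤ volume.real (Ioo R₀ (s - L)) :=
            measureReal_mono (fun ρ hρ ↦ ⟨hρ.1.1, hρ.2⟩) measure_Ioo_lt_top.ne
        _ = s - L - R₀ := Real.volume_real_Ioo_of_le (by linarith)
        _ ≤ s - R₀ := by linarith
    rw [hI]
    exact mul_le_mul_of_nonneg_right hmeas hνs
  -- Step 4: combine
  rw [step1, step2]
  exact setIntegral_mono_on hFint.integral_prod_right
    (hint.mono_set (Ioi_subset_Ioi (by linarith))) measurableSet_Ioi step3

/-- Tails `∫_{(a, ∞)} f` of a function integrable on `(R₀, ∞)` tend to `0` as `a → ∞`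
(continuity from above of the set integral along the antitone family `(a, ∞)` with empty
intersection). -/
theorem tendsto_setIntegral_Ioi_zero {R₀ : ℝ} {f : ℝ → ℝ} (hf : IntegrableOn f (Ioi R₀)) :
    Tendsto (fun a ↦ ∫ s in Ioi a, f s) atTop (𝓝 0) := by
  have h := tendsto_setIntegral_of_antitone (μ := volume) (f := f) (s := fun a : ℝ ↦ Ioi a)
    (fun _ ↦ measurableSet_Ioi) (fun _ _ hab ↦ Ioi_subset_Ioi hab) ⟨R₀, hf⟩
  have he : (⋂ a : ℝ, Ioi a) = ∅ := by
    ext x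
    simp only [mem_iInter, mem_Ioi, mem_empty_iff_false, iff_false, not_forall, not_lt]
    exact ⟨x, le_rfl⟩
  rw [he, Measure.restrict_empty, integral_zero_measure] at h
  exact h

/-- Registered stub R1 of the line `bargmann-small-late-exterior` (statement `TonelliBargmann`,
verbatim): for `ν ≥ 0` continuous on `[R₀, ∞)` with `(s − R₀) ν(s)` integrable on `(R₀, ∞)`,
`ν` is integrable on `(R₀, ∞)`; the tails `I_L(ρ) = ∫_{(ρ+L, ∞)} ν` (`L ≥ 0`) are nonnegative and
antitone in `ρ ≥ R₀`; the double integral obeys Bargmann's bound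
`∫_{R₀}^{r} I_L(ρ) dρ ≤ ∫_{(R₀+L, ∞)} (s − R₀) ν(s) ds`; and both tails `∫_{(a, ∞)} ν`,
`∫_{(a, ∞)} (s − R₀) ν` tend to `0` as `a → ∞`. -/
theorem stub_tonelliBargmann :
  ∀ (R₀ : ℝ) (ν : ℝ → ℝ), ContinuousOn ν (Set.Ici R₀) → (∀ s, R₀ ≤ s → 0 ≤ ν s) →
    IntegrableOn (fun s ↦ (s - R₀) * ν s) (Set.Ioi R₀) →
    IntegrableOn ν (Set.Ioi R₀) ∧
    (∀ L ρ, 0 ≤ L → R₀ ≤ ρ → 0 ≤ ∫ s in Set.Ioi (ρ + L), ν s) ∧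
    (∀ L, 0 ≤ L → AntitoneOn (fun ρ ↦ ∫ s in Set.Ioi (ρ + L), ν s) (Set.Ici R₀)) ∧
    (∀ L r, 0 ≤ L → R₀ ≤ r →
      ∫ ρ in R₀..r, (∫ s in Set.Ioi (ρ + L), ν s) ≤ ∫ s in Set.Ioi (R₀ + L), (s - R₀) * ν s) ∧
    Tendsto (fun a ↦ ∫ s in Set.Ioi a, ν s) atTop (𝓝 0) ∧
    Tendsto (fun a ↦ ∫ s in Set.Ioi a, (s - R₀) * ν s) atTop (𝓝 0) := by
  intro R₀ ν hc hnn hint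
  have hν : IntegrableOn ν (Ioi R₀) := integrableOn_Ioi_of_weighted hc hnn hint
  exact ⟨hν, fun L ρ hL hρ ↦ tail_nonneg hnn hL hρ, fun L hL ↦ tail_antitoneOn hnn hν hL,
    fun L r hL hr ↦ double_integral_le hnn hν hint hL hr,
    tendsto_setIntegral_Ioi_zero hν, tendsto_setIntegral_Ioi_zero hint⟩

end Summit.FinalStateConjecture.FinalStateConjecture.Theorems.NecksCertifyBargmann.Tonelli
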